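import Summits.BirchSwinnertonDyer.Rank1Residual.GaloisImage.CongruenceVisibilityIdentityComponentIndexEnds
import Summits.BirchSwinnertonDyer.Rank1Residual.GaloisImage.GoodReductionLocalTwist
import Summits.BirchSwinnertonDyer.Rank1Residual.GaloisImage.CongruenceVisibilityIdentityComponentRat
import HarnessLib

/-!
# `ι_{v₀}(θ) ≤ 3` when the PARTNER has GOOD reduction at `v₀ ∣ 3` (the add/good twin of THEOREM B
# in the comparison-index currency) (cell `b2b-bsdres`, team n1011, seat p10 GEN 9; ROW
# T-VIS3-UC-IOTA FILE 5; skeleton `cells/n1011/skel/T-VIS3-UC-IOTA.md`)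

HONEST FRAMING (cell `b2b-bsdres`, run/shared/lean/b2b/bsd-rank1-residual/, verbatim in every
file): the goal of the cell is to DELETE the COMBINATION-SHAPED residual classes of the
Birch–Swinnerton-Dyer formula for ALL analytic-rank `≤ 1` elliptic curves over `ℚ` — "full BSD
formula for every rank `≤ 1` curve in class `C`" assembled STRICTLY from published theorems — so
that the rank-`≤ 1` remainder becomes exactly the CONSTRUCTION-SHAPED classes, which are TYPED
(missing-input `Prop`s), NOT attempted. This is not "finishing BSD". Team n1011 (N10 / N11):
research route on the CONSTRUCTION-SHAPED class X4 (§I N11 LOWER half / O7); no claim beyond the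
stated classes; nothing is booked; marks UNCHANGED. Theorems only: no definition, no named fact,
no `sorry`. TOOL + RECORD-SHAPE theorems; they close nothing by themselves.

## What

The receiver `E = W` is ADDITIVE at `v₀ ∣ 3` with an identity-component `3`-torsion point
(8b's cuspidal datum), the partner `E' = W'` has GOOD reduction at `v₀` with `#E'(K_{v₀})[3] = 3`
(r1 ROUTE-1 §51: the 2 add/good D44-K rows). FILE 4's
`exists_localPoints_twist_of_hasGoodReductionAt` (Milne I.3.8 at good reduction) supplies the
partner's twist datum, FILE 8a the receiver's, and FILE 1b's abstract
`relIndex_map_selmerLocalKer_le_three_of_twists` gives **`ι_{v₀}(θ) ≤ 3`**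
(`relIndex_map_selmerLocalKer_le_three_of_identityComponent_of_hasGoodReductionAt`); then the
rank-`0` receiver END `exists_sha_ne_zero_of_congr_of_identityComponent_of_hasGoodReductionAt_of_rank_two`
through the master count, and its `ℚ` wrapper at `primesEquiv v₀ = 3`. (Both-good pairs: the same
three lines with FILE 4 twice — not needed by any n1011 row, not stated.)

Referee-1 GEN 43 provisos (i-1)–(i-5), recorded for FILES 2/3/5 together: (i-1) Mathlib's
`relIndex = 0` convention (infinite index) never fires here — every comparison index `ι_v(θ)` is
`≠ 0` by the tree's `relIndex_map_selmerLocalKer_ne_zero_and_le`, so the budgets `hbud` of FILE 2/3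
(`[E:3E] · 3 · ∏_{v ∈ S ∖ v₀} ι_v(θ) < [E':3E']`) are never vacuously small; (i-2) `hrank`, `hidxE`,
`hfin`, `hcop` are EVIDENCE binders a record displays (the rank-currency conversion of FILE 6 turns
`hrank` into two points, it does not discharge it); the rank-`1` END yields `Ш(E)[3] ≠ 0` only and
closes no `BSDp`; (i-4) the D44-K / K42 records are the records lanes' (p10 claims none; any row
count is r1's EVIDENCE); (i-5) NOT CLAIMED by this row: places with `#E(K_{v₀})[3] = 1`, σ = Φ
places (K43's Φ/Φ rows want their own place-`3` lemma), cost `0` (`ι_{v₀} = 1`; L41 as a local lemma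
is false), a new `places₇` kind, any per-row record.
References: [CremonaMazur2000] §3; [AgasheStein2002] §3.5; [MilneADT2006] I.3.3, I.3.8;
L41-NOTE §§1–2 (`HOME/b2b-bsdres-n1011-p10/g8/`). -/

noncomputable section

open scoped Classical

namespace Summit.BirchSwinnertonDyer.Rank1Residual.GaloisImage.TwistedWitness

open WeierstrassCurve Literature.NumberTheory.EllipticCurves Literature.NumberTheory.GaloisRepresentations
open Field NumberField IsDedekindDomain IsDedekindDomain.HeightOneSpectrum Rat.HeightOneSpectrum

section General

variable {K : Type} [Field K] [NumberField K] (W W' : WeierstrassCurve K) [W.IsElliptic] [W'.IsElliptic]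

/-- **`ι_{v₀}(θ) ≤ 3`, receiver σ = E0 (additive, identity-component `3`-torsion point), partner of
GOOD reduction at `v₀ ∣ 3`.** Binders at `v₀`: `#(𝓞_{v₀}/3) = 3`, the three `ℚ₃`-facts,
`#E(K_{v₀})[3] = #E'(K_{v₀})[3] = 3`, the receiver's cuspidal integral model with its `3`-torsion
point of nonsingular reduction, and `W'.HasGoodReductionAt v₀`.
[cite: CremonaMazur2000, §3 pp. 19–22] [cite: MilneADT2006, Ch. I Prop. 3.8 and Lemma 3.3] -/
theorem relIndex_map_selmerLocalKer_le_three_of_identityComponent_of_hasGoodReductionAt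
    (θ : geomTorsion W' ((3 : ℕ) : ℤ) ≃+ geomTorsion W ((3 : ℕ) : ℤ))
    (hθ : ∀ (σ : absoluteGaloisGroup K) (P : geomTorsion W' ((3 : ℕ) : ℤ)), θ (σ • P) = σ • θ P)
    (v₀ : HeightOneSpectrum (𝓞 K)) (h3v : ((3 : ℕ) : 𝓞 K) ∈ v₀.asIdeal)
    (hO3 : Nat.card (v₀.adicCompletionIntegers K ⧸
      Ideal.span {((3 : ℕ) : v₀.adicCompletionIntegers K)}) = 3)
    {δ : v₀.adicCompletion K} (hδ : δ ^ 2 = -23)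
    (hnoroot : ∀ x : v₀.adicCompletion K, x ^ 3 - x - 1 ≠ 0)
    (hn3 : ∀ y : v₀.adicCompletion K, y ^ 2 ≠ -3)
    (hcard : Nat.card (nsmulAddMonoidHom 3 :
      (W.baseChange (v₀.adicCompletion K)).toAffine.Point →+ _).ker = 3)
    (hcard' : Nat.card (nsmulAddMonoidHom 3 :
      (W'.baseChange (v₀.adicCompletion K)).toAffine.Point →+ _).ker = 3)
    (M : WeierstrassCurve (v₀.adicCompletionIntegers K)) (C : VariableChange (v₀.adicCompletion K))
    (hC : C • W.baseChange (v₀.adicCompletion K) =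
      M.map (algebraMap (v₀.adicCompletionIntegers K) (v₀.adicCompletion K)))
    (x₀ y₀ a : IsLocalRing.ResidueField (v₀.adicCompletionIntegers K))
    (hcusp : M.map (IsLocalRing.residue (v₀.adicCompletionIntegers K)) = singularModel x₀ y₀ a a)
    {a₀ b₀ : v₀.adicCompletionIntegers K}
    (hns₀ : (M.map (IsLocalRing.residue (v₀.adicCompletionIntegers K))).toAffine.Nonsingular
      (IsLocalRing.residue (v₀.adicCompletionIntegers K) a₀)
      (IsLocalRing.residue (v₀.adicCompletionIntegers K) b₀))
    (hm : ((M.map (algebraMap (v₀.adicCompletionIntegers K) (v₀.adicCompletion K))).baseChange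
        (AlgebraicClosure (v₀.adicCompletion K))).toAffine.Nonsingular
      (algebraMap (v₀.adicCompletionIntegers K) (AlgebraicClosure (v₀.adicCompletion K)) a₀)
      (algebraMap (v₀.adicCompletionIntegers K) (AlgebraicClosure (v₀.adicCompletion K)) b₀))
    (h3 : (3 : ℤ) • (Affine.Point.some _ _ hm :
      ((M.map (algebraMap (v₀.adicCompletionIntegers K) (v₀.adicCompletion K))).baseChange
        (AlgebraicClosure (v₀.adicCompletion K))).toAffine.Point) = 0)
    (hgood' : W'.HasGoodReductionAt v₀) :
    (selmerLocalKer W (v₀.adicCompletion K) ((3 : ℕ) : ℤ)).relIndex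
      ((selmerLocalKer W' (v₀.adicCompletion K) ((3 : ℕ) : ℤ)).map
        (h1Equiv θ hθ).toAddMonoidHom) ≤ 3 := by
  haveI : Fact (Nat.Prime 3) := ⟨Nat.prime_three⟩
  haveI : CharZero (v₀.adicCompletion K) := charZero_adicCompletion v₀
  obtain ⟨α, hα⟩ := exists_cubicRoot (v₀.adicCompletion K)
  obtain ⟨F₀, hF₀H⟩ := exists_smul_cubicRoot_ne hα hδ hnoroot
  have hF₀ : F₀ • α ≠ α := fun h ↦ hF₀H (MulAction.mem_stabilizer_iff.mpr h)
  -- receiver: THEOREM A at the cusp (FILE 8a)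
  obtain ⟨Q₁, T₁, hT₁0, -, -, hQ₁H, hQ₁F, hQ₁3⟩ :=
    exists_localPoints_twist_of_identityComponent W h3v M C hC x₀ y₀ a hcusp hα hδ hnoroot F₀ hF₀ hns₀ hm h3
  -- partner: a non-zero `K_{v₀}`-rational `3`-torsion point, read in `E'(K̄_{v₀})`
  haveI : Finite (nsmulAddMonoidHom 3 :
      (W'.baseChange (v₀.adicCompletion K)).toAffine.Point →+ _).ker :=
    Nat.finite_of_card_ne_zero (by rw [hcard']; norm_num)
  have hnt : Nontrivial (nsmulAddMonoidHom 3 :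
      (W'.baseChange (v₀.adicCompletion K)).toAffine.Point →+ _).ker := by
    rw [← Finite.one_lt_card_iff_nontrivial, hcard']; norm_num
  obtain ⟨⟨R, hRker⟩, hR0⟩ := exists_ne (0 : (nsmulAddMonoidHom 3 :
      (W'.baseChange (v₀.adicCompletion K)).toAffine.Point →+ _).ker)
  have hR0' : R ≠ 0 := fun h ↦ hR0 (Subtype.ext h)
  rw [AddMonoidHom.mem_ker, nsmulAddMonoidHom_apply] at hRker
  set ψ : (W'.baseChange (v₀.adicCompletion K)).toAffine.Point →+ localPoints W' (v₀.adicCompletion K) :=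
    (W'.baseChangeGeomPointsEquiv (v₀.adicCompletion K)).toAddMonoidHom.comp
      (toGeomPoints (W'.baseChange (v₀.adicCompletion K))) with hψdef
  have hψinj : Function.Injective ψ := fun R R' h ↦
    toGeomPoints_injective (W'.baseChange (v₀.adicCompletion K))
      ((W'.baseChangeGeomPointsEquiv (v₀.adicCompletion K)).injective h)
  have hψfix : ∀ R (σ : absoluteGaloisGroup (v₀.adicCompletion K)), σ • ψ R = ψ R := fun R σ ↦
    VisibleWitness.baseChangeGeomPointsEquiv_toGeomPoints_mem_fixedPoints W' (v₀.adicCompletion K) R σ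
  have hT3 : (3 : ℤ) • ψ R = 0 := by
    rw [← map_zsmul, show (3 : ℤ) • R = (3 : ℕ) • R from by norm_cast, hRker, map_zero]
  obtain ⟨Q₀', hQ₀'H, hQ₀'F, hQ₀'3⟩ := exists_localPoints_twist_of_hasGoodReductionAt W' hgood' h3v hα hδ
    hnoroot F₀ hF₀ (ψ R) hT3 (hψfix R)
  have hQ₀'F' : F₀ • Q₀' ≠ Q₀' := by
    intro h
    apply hR0'
    apply hψinj
    rw [map_zero, ← hQ₀'F, h, sub_self]
  exact relIndex_map_selmerLocalKer_le_three_of_twists W W' θ hθ v₀ hO3 hδ hnoroot hn3 hcard hcard' hα F₀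
    hF₀ Q₁ hQ₁H (fun h ↦ hT₁0 (by rw [← hQ₁F, h, sub_self])) hQ₁3 Q₀' hQ₀'H hQ₀'F' hQ₀'3

/-- **The rank-`0` receiver shape, partner GOOD at `v₀`: `Ш(E/K)[3] ≠ 0`** (`E(K)` finite of order
prime to `3`, `2 ≤ rank E'(K)`, agreement along `θ` off `v₀`; the master count with
`ι_{v₀}(θ) ≤ 3`). [cite: CremonaMazur2000, §3 and Table 1] [cite: AgasheStein2002, Thm. 3.1]
[cite: MilneADT2006, Ch. I Prop. 3.8 and Lemma 3.3] -/
theorem exists_sha_ne_zero_of_congr_of_identityComponent_of_hasGoodReductionAt_of_rank_two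
    (θ : geomTorsion W' ((3 : ℕ) : ℤ) ≃+ geomTorsion W ((3 : ℕ) : ℤ))
    (hθ : ∀ (σ : absoluteGaloisGroup K) (P : geomTorsion W' ((3 : ℕ) : ℤ)), θ (σ • P) = σ • θ P)
    (S : Finset (HeightOneSpectrum (𝓞 K)))
    (hS : ∀ v : HeightOneSpectrum (𝓞 K), v ∉ S →
      W.HasGoodReductionAt v ∧ W'.HasGoodReductionAt v ∧ ((3 : ℕ) : 𝓞 K) ∉ v.asIdeal)
    (hfin : Finite W.toAffine.Point) (hcop : (Nat.card W.toAffine.Point).Coprime 3)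
    (hrank : 2 ≤ W'.mordellWeilRank)
    (v₀ : HeightOneSpectrum (𝓞 K)) (h3v : ((3 : ℕ) : 𝓞 K) ∈ v₀.asIdeal)
    (hO3 : Nat.card (v₀.adicCompletionIntegers K ⧸
      Ideal.span {((3 : ℕ) : v₀.adicCompletionIntegers K)}) = 3)
    {δ : v₀.adicCompletion K} (hδ : δ ^ 2 = -23)
    (hnoroot : ∀ x : v₀.adicCompletion K, x ^ 3 - x - 1 ≠ 0)
    (hn3 : ∀ y : v₀.adicCompletion K, y ^ 2 ≠ -3)
    (hoff : ∀ v ∈ S, v ≠ v₀ →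
      (selmerLocalKer W (v.adicCompletion K) ((3 : ℕ) : ℤ)).relIndex
        ((selmerLocalKer W' (v.adicCompletion K) ((3 : ℕ) : ℤ)).map (h1Equiv θ hθ).toAddMonoidHom) = 1)
    (hcard : Nat.card (nsmulAddMonoidHom 3 :
      (W.baseChange (v₀.adicCompletion K)).toAffine.Point →+ _).ker = 3)
    (hcard' : Nat.card (nsmulAddMonoidHom 3 :
      (W'.baseChange (v₀.adicCompletion K)).toAffine.Point →+ _).ker = 3)
    (M : WeierstrassCurve (v₀.adicCompletionIntegers K)) (C : VariableChange (v₀.adicCompletion K))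
    (hC : C • W.baseChange (v₀.adicCompletion K) =
      M.map (algebraMap (v₀.adicCompletionIntegers K) (v₀.adicCompletion K)))
    (x₀ y₀ a : IsLocalRing.ResidueField (v₀.adicCompletionIntegers K))
    (hcusp : M.map (IsLocalRing.residue (v₀.adicCompletionIntegers K)) = singularModel x₀ y₀ a a)
    {a₀ b₀ : v₀.adicCompletionIntegers K}
    (hns₀ : (M.map (IsLocalRing.residue (v₀.adicCompletionIntegers K))).toAffine.Nonsingular
      (IsLocalRing.residue (v₀.adicCompletionIntegers K) a₀)
      (IsLocalRing.residue (v₀.adicCompletionIntegers K) b₀))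
    (hm : ((M.map (algebraMap (v₀.adicCompletionIntegers K) (v₀.adicCompletion K))).baseChange
        (AlgebraicClosure (v₀.adicCompletion K))).toAffine.Nonsingular
      (algebraMap (v₀.adicCompletionIntegers K) (AlgebraicClosure (v₀.adicCompletion K)) a₀)
      (algebraMap (v₀.adicCompletionIntegers K) (AlgebraicClosure (v₀.adicCompletion K)) b₀))
    (h3 : (3 : ℤ) • (Affine.Point.some _ _ hm :
      ((M.map (algebraMap (v₀.adicCompletionIntegers K) (v₀.adicCompletion K))).baseChange
        (AlgebraicClosure (v₀.adicCompletion K))).toAffine.Point) = 0)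
    (hgood' : W'.HasGoodReductionAt v₀) :
    ∃ c : W.sha, c ≠ 0 ∧ 3 • c = 0 := by
  haveI : Fact (Nat.Prime 3) := ⟨Nat.prime_three⟩
  haveI := hfin
  have hv₀S : v₀ ∈ S := by
    by_contra h
    exact (hS v₀ h).2.2 h3v
  have hι := relIndex_map_selmerLocalKer_le_three_of_identityComponent_of_hasGoodReductionAt W W' θ hθ
    v₀ h3v hO3 hδ hnoroot hn3 hcard hcard' M C hC x₀ y₀ a hcusp hns₀ hm h3 hgood'
  refine W.exists_sha_ne_zero_of_congr_of_relIndex_lt W' (p := 3) (by norm_num) θ hθ S hS ?_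
  rw [← Finset.mul_prod_erase S _ hv₀S, Finset.prod_eq_one (fun v hv ↦
    hoff v (Finset.mem_of_mem_erase hv) (Finset.ne_of_mem_erase hv)), mul_one,
    index_range_zsmul_eq_one_of_coprime hcop, one_mul]
  calc _ ≤ 3 := hι
    _ < 3 ^ 2 := by norm_num
    _ ≤ 3 ^ W'.mordellWeilRank := Nat.pow_le_pow_right (by norm_num) hrank
    _ ≤ _ := pow_mordellWeilRank_le_index_range_zsmul W' (by norm_num)

end General

/-- **The rank-`0` receiver shape over `ℚ` at `3`, partner GOOD at `3`** (side inputs at `3`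
discharged as in FILE 8d). [cite: CremonaMazur2000, §3 and Table 1] [cite: AgasheStein2002, Thm. 3.1]
[cite: MilneADT2006, Ch. I Prop. 3.8 and Lemma 3.3] -/
theorem exists_sha_ne_zero_of_congr_of_identityComponent_of_hasGoodReductionAt_of_rank_two_rat
    (W W' : WeierstrassCurve ℚ) [W.IsElliptic] [W'.IsElliptic]
    (θ : geomTorsion W' ((3 : ℕ) : ℤ) ≃+ geomTorsion W ((3 : ℕ) : ℤ))
    (hθ : ∀ (σ : absoluteGaloisGroup ℚ) (P : geomTorsion W' ((3 : ℕ) : ℤ)), θ (σ • P) = σ • θ P)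
    (S : Finset (HeightOneSpectrum (𝓞 ℚ)))
    (hS : ∀ v : HeightOneSpectrum (𝓞 ℚ), v ∉ S →
      W.HasGoodReductionAt v ∧ W'.HasGoodReductionAt v ∧ ((3 : ℕ) : 𝓞 ℚ) ∉ v.asIdeal)
    (hfin : Finite W.toAffine.Point) (hcop : (Nat.card W.toAffine.Point).Coprime 3)
    (hrank : 2 ≤ W'.mordellWeilRank)
    (v₀ : HeightOneSpectrum (𝓞 ℚ)) (hv₀ : (primesEquiv v₀ : ℕ) = 3)
    (hoff : ∀ v ∈ S, v ≠ v₀ →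
      (selmerLocalKer W (v.adicCompletion ℚ) ((3 : ℕ) : ℤ)).relIndex
        ((selmerLocalKer W' (v.adicCompletion ℚ) ((3 : ℕ) : ℤ)).map (h1Equiv θ hθ).toAddMonoidHom) = 1)
    (hcard : Nat.card (nsmulAddMonoidHom 3 :
      (W.baseChange (v₀.adicCompletion ℚ)).toAffine.Point →+ _).ker = 3)
    (hcard' : Nat.card (nsmulAddMonoidHom 3 :
      (W'.baseChange (v₀.adicCompletion ℚ)).toAffine.Point →+ _).ker = 3)
    (M : WeierstrassCurve (v₀.adicCompletionIntegers ℚ)) (C : VariableChange (v₀.adicCompletion ℚ))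
    (hC : C • W.baseChange (v₀.adicCompletion ℚ) =
      M.map (algebraMap (v₀.adicCompletionIntegers ℚ) (v₀.adicCompletion ℚ)))
    (x₀ y₀ a : IsLocalRing.ResidueField (v₀.adicCompletionIntegers ℚ))
    (hcusp : M.map (IsLocalRing.residue (v₀.adicCompletionIntegers ℚ)) = singularModel x₀ y₀ a a)
    {a₀ b₀ : v₀.adicCompletionIntegers ℚ}
    (hns₀ : (M.map (IsLocalRing.residue (v₀.adicCompletionIntegers ℚ))).toAffine.Nonsingular
      (IsLocalRing.residue (v₀.adicCompletionIntegers ℚ) a₀)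
      (IsLocalRing.residue (v₀.adicCompletionIntegers ℚ) b₀))
    (hm : ((M.map (algebraMap (v₀.adicCompletionIntegers ℚ) (v₀.adicCompletion ℚ))).baseChange
        (AlgebraicClosure (v₀.adicCompletion ℚ))).toAffine.Nonsingular
      (algebraMap (v₀.adicCompletionIntegers ℚ) (AlgebraicClosure (v₀.adicCompletion ℚ)) a₀)
      (algebraMap (v₀.adicCompletionIntegers ℚ) (AlgebraicClosure (v₀.adicCompletion ℚ)) b₀))
    (h3 : (3 : ℤ) • (Affine.Point.some _ _ hm :
      ((M.map (algebraMap (v₀.adicCompletionIntegers ℚ) (v₀.adicCompletion ℚ))).baseChange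
        (AlgebraicClosure (v₀.adicCompletion ℚ))).toAffine.Point) = 0)
    (hgood' : W'.HasGoodReductionAt v₀) :
    ∃ c : W.sha, c ≠ 0 ∧ 3 • c = 0 := by
  obtain ⟨⟨δ, hδ⟩, hn3, hnoroot⟩ := three_facts_adicCompletion_three hv₀
  exact exists_sha_ne_zero_of_congr_of_identityComponent_of_hasGoodReductionAt_of_rank_two W W' θ hθ
    S hS hfin hcop hrank v₀
    (Literature.NumberTheory.EllipticCurves.Rank1Residual.natCast_mem_asIdeal_of_primesEquiv_eq hv₀)
    (natCard_quot_three_of_primesEquiv_eq hv₀) hδ hnoroot hn3 hoff hcard hcard'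
    M C hC x₀ y₀ a hcusp hns₀ hm h3 hgood'

end Summit.BirchSwinnertonDyer.Rank1Residual.GaloisImage.TwistedWitness

end
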